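import Literature.Probability.LatticeModels.LatticeDirichletEnergy
import Mathlib.Probability.Distributions.Gaussian.Multivariate
import Literature.MathematicalPhysics.QuantumFieldTheory.GaussianToolkit
import HarnessLib

/-!
# The massless lattice Gaussian free field with zero boundary condition: Gibbs form,
Wilson-type observables `E cos φ(f) = exp(-E_S(f)/2β)`, and their perimeter law in `d ≥ 4`

Topic `Literature/Probability/LatticeModels`; companion of `LatticeDirichletEnergy.lean` (Dirichlet
form `dirichletForm`, Dirichlet Green energy `dirichletEnergy S f = ⟨f, (-Δ_D)⁻¹ f⟩`, its domination
by the free Coulomb energy and the perimeter bound for loop currents) and of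
`DirichletGreenFunction.lean` (the Dirichlet Laplacian matrix `dirichletMatrix S = -Δ_D` of a finite
`S ⊆ ℤ^d`, invertible for `d ≥ 1`, and its Green function `dirichletGreen`). Everything here is
PROVED; no named fact is introduced.

* `eq_zero_of_dirichletForm_eq_zero`, `eq_zero_of_dirichletEnergy_eq_zero` — **definiteness**
  (`d ≥ 1`): `𝓔_S(u) = 0` forces `u = 0` (all lattice gradients vanish, and a translate of any
  point leaves the finite set `S`), so `E_S` is positive definite on charges in `S`.
* `dotProduct_dirichletMatrix_mulVec` (`vᵀ(-Δ_D)v = 𝓔_S(v̄)`, `v̄` the zero extension),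
  **`posDef_dirichletMatrix`** and `posDef_inv_dirichletMatrix` (Glimm–Jaffe Prop. 9.5.2 with
  definiteness), `dotProduct_inv_dirichletMatrix_mulVec` (`vᵀ(-Δ_D)⁻¹v = E_S(v̄)`).
* **`latticeGFF β S`** — the massless lattice Gaussian free field (harmonic crystal) on `S` with
  zero boundary condition at inverse temperature `β`: the centred Gaussian on `ℝ^S` with covariance
  `β⁻¹ (-Δ_D)⁻¹` (Mathlib's `ProbabilityTheory.multivariateGaussian`); `covariance_latticeGFF`
  (`E φ_x φ_y = β⁻¹ G_S(x,y)`); **`latticeGFF_eq_withDensity`**: for `β > 0`, `d ≥ 1` it is the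
  Gibbs measure `Z⁻¹ exp(-(β/2) ∑_{bonds of ℤ^d} (φ̄_x - φ̄_y)²) dφ`, `Z ∈ (0,∞)`
  (`gaussWeight_smul_dirichletMatrix`, through the tree's
  `GaussianToolkit.multivariateGaussian_inv_eq_withDensity`) — i.e. exactly the "Dirichlet
  Gaussian lattice measure" of Glimm–Jaffe §9.5 (covariance `C_{δ,D} = (-Δ_{δ,D})⁻¹`, here
  massless) and Fröhlich–Spencer 1982 §2.4.
* **`integral_cos_sum_mul_latticeGFF`**: `E cos(∑_x v(x) φ_x) = exp(-E_S(v̄)/(2β))` — Gaussian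
  integration of a Wilson-type observable (the characteristic function of `N(0, β⁻¹G_S)`,
  Glimm–Jaffe (6.2.2) in finite dimensions).
* **`exp_neg_perimeter_le_prod_integral_cos_loopCurrent`** (`d ≥ 4`): there is `C = C_d` with
  `∏_μ E_{GFF(β,S)} cos(φ(j_μ)) ≥ exp(-C (R + T)/β)` for every `β > 0`, every finite region `S`
  and every `R × T` lattice rectangle inside it, `j = loopCurrent a i j R T` — **the spin-wave
  (free lattice photon, Feynman gauge) Wilson loop obeys a perimeter law uniformly in the
  volume**, by `integral_cos_sum_mul_latticeGFF` and `sum_dirichletEnergy_loopCurrent_le`. This is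
  the Gaussian step `⟨W(ℒ)⟩ ≥ exp[-(1/2β')(ε_Λ, ε_Λ)]`, `(ε_Λ, ε_Λ) ≤ const (L + T)` of
  Fröhlich–Spencer's proof of the `U(1)₄` perimeter law ((2.88)), in the componentwise lattice
  potential theory of `ℤ^d`; the duality transformation producing FS82's own `ε_Λ` is not
  formalised here.

## References

* J. Glimm, A. Jaffe, *Quantum Physics* (2nd ed., 1987), §6.2 (6.2.2) (Gaussian generating
  functional), §9.5 (9.5.8)–(9.5.10), Prop. 9.5.2 (lattice Dirichlet Laplacian and covariance).
  [GlimmJaffe1987]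
* J. Fröhlich, T. Spencer, Comm. Math. Phys. 83 (1982) 411–454, §2.4 (Dirichlet Gaussian lattice
  measure), §2.10 (2.88). [FrohlichSpencerCMP1982]
* C. Garban, A. Sepúlveda, IMRN 2023 (arXiv:2107.04021), (1.3)–(1.5) (`E_GFF[W_γ]`).
  [GarbanSepulveda2023]
-/

noncomputable section

namespace Literature.Probability.LatticeModels

open MeasureTheory ProbabilityTheory Finset Real Matrix WithLp
open Literature.MathematicalPhysics.QuantumFieldTheory.GaussianToolkit (gaussWeight gaussZ
  multivariateGaussian_inv_eq_withDensity)
open scoped ENNReal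

variable {d : ℕ}

/-! ### Definiteness of the Dirichlet form -/

/-- **Definiteness**: a function vanishing off the finite region `S` with `𝓔_S(u) = 0` is zero
(`d ≥ 1`): all lattice gradients vanish (`dirichletForm_eq_finsum_sq`), so `u` is invariant under
the unit translations, and a translate of any point leaves the finite set `S`. [folklore] -/
theorem eq_zero_of_dirichletForm_eq_zero (hd : 0 < d) {S : Finset (Site d)} {u : Site d → ℝ}
    (hu : ∀ x ∉ S, u x = 0) (h0 : dirichletForm S u = 0) : u = 0 := by
  have hf : u.HasFiniteSupport := hasFiniteSupport_of_forall_not_mem hu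
  set F : Site d → ℝ := fun x => ∑ i : Fin d, (u (x + Pi.single i 1) - u x) ^ 2 with hF_def
  have hFnn : ∀ x, 0 ≤ F x := fun x => Finset.sum_nonneg fun i _ => sq_nonneg _
  have hF : F.HasFiniteSupport := by
    have h : ∀ i : Fin d, (fun x => (u (x + Pi.single i 1) - u x) ^ 2).HasFiniteSupport := by
      intro i
      have h1 : (fun x => u (x + Pi.single i 1)).HasFiniteSupport :=
        hf.fun_comp_of_injective (add_left_injective (Pi.single i 1 : Site d))
      have h2 : (fun x => u (x + Pi.single i 1) - u x).HasFiniteSupport := h1.sub hf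
      have h3 : (fun x => (u (x + Pi.single i 1) - u x) *
          (u (x + Pi.single i 1) - u x)).HasFiniteSupport := h2.mul_left _
      simpa only [sq] using h3
    exact Function.HasFiniteSupport.sum h Finset.univ
  rw [dirichletForm_eq_finsum_sq S hu, finsum_eq_sum _ hF] at h0
  have hall : ∀ x, F x = 0 := by
    intro x
    by_cases hx : x ∈ hF.toFinset
    · exact (Finset.sum_eq_zero_iff_of_nonneg fun y _ => hFnn y).1 h0 x hx
    · rwa [Set.Finite.mem_toFinset, Function.mem_support, not_not] at hx
  have hstep : ∀ (x : Site d) (i : Fin d), u (x + Pi.single i 1) = u x := by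
    intro x i
    have h := (Finset.sum_eq_zero_iff_of_nonneg fun i _ => sq_nonneg _).1 (hall x) i
      (Finset.mem_univ i)
    rwa [sq_eq_zero_iff, sub_eq_zero] at h
  let i : Fin d := ⟨0, hd⟩
  funext x
  have hn : ∀ n : ℕ, u (x + n • (Pi.single i 1 : Site d)) = u x := by
    intro n
    induction n with
    | zero => simp
    | succ n ih => rw [succ_nsmul, ← add_assoc, hstep, ih]
  by_contra hux
  have hmem : ∀ n : ℕ, x + n • (Pi.single i 1 : Site d) ∈ (S : Set (Site d)) := fun n => by
    by_contra hnS
    exact hux (by rw [← hn n, hu _ (fun h => hnS (Finset.mem_coe.2 h)), Pi.zero_apply])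
  have hinf := Set.infinite_range_of_injective (add_nsmul_single_injective x i)
  exact hinf (S.finite_toSet.subset (Set.range_subset_iff.2 hmem))

/-- The Dirichlet Green energy is **positive definite** on charges in the region: `E_S(f) = 0`
forces `f = 0` on `S` (`d ≥ 1`). [folklore] -/
theorem eq_zero_of_dirichletEnergy_eq_zero (hd : 0 < d) {S : Finset (Site d)} {f : Site d → ℝ}
    (h0 : dirichletEnergy S f = 0) {x : Site d} (hx : x ∈ S) : f x = 0 := by
  have hu0 : ∀ y ∉ S, dirichletSolution S f y = 0 := fun y hy => dirichletSolution_eq_zero S f hy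
  rw [dirichletEnergy_eq_dirichletForm hd S f] at h0
  have hu := eq_zero_of_dirichletForm_eq_zero hd hu0 h0
  rw [← neg_latticeLaplacianZd_dirichletSolution hd S f hx, hu, latticeLaplacianZd_zero, neg_zero]

/-! ### The Dirichlet Laplacian matrix: quadratic form, positive definiteness, inverse -/

/-- The quadratic form of the Dirichlet Laplacian matrix `M_S = -Δ_D` of
`DirichletGreenFunction.lean` is the Dirichlet form of the zero extension:
`vᵀ M_S v = 𝓔_S(zeroExtend v)` (Glimm–Jaffe (9.5.10)). [cite: GlimmJaffe1987, §9.5 (9.5.10)] -/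
theorem dotProduct_dirichletMatrix_mulVec (S : Finset (Site d)) (v : S → ℝ) :
    v ⬝ᵥ (dirichletMatrix S *ᵥ v) = dirichletForm S (zeroExtend S v) := by
  rw [dotProduct, dirichletForm,
    ← Finset.sum_coe_sort S (fun y => zeroExtend S v y * -latticeLaplacianZd (zeroExtend S v) y)]
  refine Finset.sum_congr rfl fun y _ => ?_
  rw [mulVec_dirichletMatrix, zeroExtend_coe]

/-- `zeroExtend v = 0` only for `v = 0`. [folklore] -/
theorem zeroExtend_eq_zero_iff (S : Finset (Site d)) (v : S → ℝ) : zeroExtend S v = 0 ↔ v = 0 := by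
  constructor
  · intro h
    funext y
    have := congr_fun h y
    rwa [zeroExtend_coe, Pi.zero_apply] at this
  · rintro rfl
    funext y
    by_cases hy : y ∈ S
    · rw [zeroExtend_of_mem _ hy]; rfl
    · rw [zeroExtend_of_not_mem _ hy]; rfl

/-- **`M_S = -Δ_D` is positive definite** (`d ≥ 1`; Glimm–Jaffe Prop. 9.5.2, `0 ≤ -Δ_{δ,D}`, with
definiteness from the zero boundary condition, `eq_zero_of_dirichletForm_eq_zero`).
[cite: GlimmJaffe1987, §9.5 Prop. 9.5.2] -/
theorem posDef_dirichletMatrix (hd : 0 < d) (S : Finset (Site d)) : (dirichletMatrix S).PosDef := by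
  rw [posDef_iff_dotProduct_mulVec]
  refine ⟨?_, fun v hv => ?_⟩
  · rw [IsHermitian, conjTranspose, dirichletMatrix_transpose]
    rfl
  · rw [star_trivial, dotProduct_dirichletMatrix_mulVec]
    have h0 : ∀ x ∉ S, zeroExtend S v x = 0 := fun x hx => zeroExtend_of_not_mem v hx
    refine lt_of_le_of_ne (dirichletForm_nonneg S h0) fun h => hv ?_
    exact (zeroExtend_eq_zero_iff S v).1 (eq_zero_of_dirichletForm_eq_zero hd h0 h.symm)

/-- **`M_S⁻¹` (the Dirichlet Green matrix) is positive definite** (`d ≥ 1`). [folklore] -/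
theorem posDef_inv_dirichletMatrix (hd : 0 < d) (S : Finset (Site d)) :
    (dirichletMatrix S)⁻¹.PosDef :=
  (posDef_dirichletMatrix hd S).inv

/-- The quadratic form of the Dirichlet Green matrix `M_S⁻¹ = (G_S(x,y))_{x,y ∈ S}` is the
Dirichlet Green energy of the zero-extended charge: `vᵀ M_S⁻¹ v = E_S(zeroExtend v)`. [folklore] -/
theorem dotProduct_inv_dirichletMatrix_mulVec (S : Finset (Site d)) (v : S → ℝ) :
    v ⬝ᵥ ((dirichletMatrix S)⁻¹ *ᵥ v) = dirichletEnergy S (zeroExtend S v) := by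
  rw [dirichletEnergy_eq_sum_sum, dotProduct]
  simp only [mulVec, dotProduct, Finset.mul_sum]
  rw [← Finset.sum_coe_sort S]
  refine Finset.sum_congr rfl fun x _ => ?_
  rw [← Finset.sum_coe_sort S]
  refine Finset.sum_congr rfl fun y _ => ?_
  rw [zeroExtend_coe, zeroExtend_coe, dirichletGreen_of_mem x.2 y.2]
  ring

/-- The Dirichlet energy only depends on the charge inside the region. [folklore] -/
theorem dirichletEnergy_congr {S : Finset (Site d)} {f g : Site d → ℝ}
    (h : ∀ x ∈ S, f x = g x) : dirichletEnergy S f = dirichletEnergy S g := by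
  unfold dirichletEnergy
  rw [dirichletSolution_congr h]
  exact Finset.sum_congr rfl fun x hx => by rw [h x hx]

/-- `zeroExtend` of the restriction of `f` agrees with `f` on the region. [folklore] -/
theorem zeroExtend_restrict_eq {S : Finset (Site d)} (f : Site d → ℝ) {x : Site d} (hx : x ∈ S) :
    zeroExtend S (fun y : S => f y) x = f x := by
  rw [zeroExtend_of_mem _ hx]

/-! ### The massless lattice Gaussian free field with zero boundary condition -/

/-- **The massless lattice Gaussian free field (harmonic crystal) on the finite region `S ⊆ ℤ^d`
with zero (Dirichlet) boundary condition, at inverse temperature `β`**: the centred Gaussian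
measure on `ℝ^S` with covariance `β⁻¹ G_S`, `G_S = (-Δ_D)⁻¹` the Dirichlet Green function —
equivalently (for `β > 0`, `d ≥ 1`) the Gibbs measure `Z⁻¹ exp(-(β/2) ∑_{bonds} (φ_x - φ_y)²) dφ`
with `φ = 0` off `S` (Glimm–Jaffe §9.5: the lattice Dirichlet covariance `C_{δ,D} = (-Δ_{δ,D})⁻¹`,
here massless; Fröhlich–Spencer 1982 §2.4, "the Dirichlet Gaussian lattice measure and its
Green's function"). Realised through Mathlib's `ProbabilityTheory.multivariateGaussian`.
[cite: GlimmJaffe1987, §9.5 (9.5.8)–(9.5.10) and Prop. 9.5.2] -/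
def latticeGFF (β : ℝ) (S : Finset (Site d)) : Measure (EuclideanSpace ℝ S) :=
  multivariateGaussian 0 (β⁻¹ • (dirichletMatrix S)⁻¹)

/-- The lattice GFF is a probability measure (a Gaussian measure). [folklore] -/
instance isProbabilityMeasure_latticeGFF (β : ℝ) (S : Finset (Site d)) :
    IsProbabilityMeasure (latticeGFF β S) := by
  unfold latticeGFF; infer_instance

/-- The covariance matrix `β⁻¹ G_S` is positive semidefinite (`β ≥ 0`, `d ≥ 1`). [folklore] -/
theorem posSemidef_smul_inv_dirichletMatrix (hd : 0 < d) {β : ℝ} (hβ : 0 ≤ β) (S : Finset (Site d)) :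
    (β⁻¹ • (dirichletMatrix S)⁻¹).PosSemidef :=
  (posDef_inv_dirichletMatrix hd S).posSemidef.smul (inv_nonneg.2 hβ)

/-- **Two-point function**: `E[φ_x φ_y] = β⁻¹ G_S(x, y)` (`β ≥ 0`, `d ≥ 1`). [folklore] -/
theorem covariance_latticeGFF (hd : 0 < d) {β : ℝ} (hβ : 0 ≤ β) (S : Finset (Site d)) (x y : S) :
    cov[fun φ : EuclideanSpace ℝ S => ofLp φ x, fun φ : EuclideanSpace ℝ S => ofLp φ y;
      latticeGFF β S] = β⁻¹ * dirichletGreen S x y := by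
  unfold latticeGFF
  rw [covariance_eval_multivariateGaussian (posSemidef_smul_inv_dirichletMatrix hd hβ S),
    Matrix.smul_apply, smul_eq_mul, dirichletGreen_of_mem x.2 y.2]

/-- The real inner product of `ℝ^S` against `toLp 2 v` is the pairing `∑_x v(x) φ_x`. [folklore] -/
theorem inner_toLp_eq_sum {S : Finset (Site d)} (φ : EuclideanSpace ℝ S) (v : S → ℝ) :
    @inner ℝ _ _ φ (toLp 2 v) = ∑ x : S, v x * ofLp φ x := by
  rw [EuclideanSpace.inner_eq_star_dotProduct]
  simp [dotProduct]

/-- **Gaussian integration of a Wilson-type (cosine) observable**: for the lattice GFF with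
zero boundary condition, `E cos(∑_{x ∈ S} v(x) φ_x) = exp(-E_S(v)/(2β))` with `E_S` the Dirichlet
Green energy of the charge `v` (`β > 0`, `d ≥ 1`) — the characteristic function of the centred
Gaussian `N(0, β⁻¹ G_S)` (Glimm–Jaffe (6.2.2) `S{f} = e^{-⟨f, Cf⟩/2}` in finite dimensions; the
form `⟨e^{iφ(f)}⟩ = exp[-(1/2β)(f, C_D f)]` of the spin-wave factor in Fröhlich–Spencer 1982
§2.4–2.10). [cite: GlimmJaffe1987, §6.2 (6.2.2)] -/
theorem integral_cos_sum_mul_latticeGFF (hd : 0 < d) {β : ℝ} (hβ : 0 < β) (S : Finset (Site d))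
    (v : S → ℝ) :
    ∫ φ, Real.cos (∑ x : S, v x * ofLp φ x) ∂(latticeGFF β S) =
      Real.exp (-dirichletEnergy S (zeroExtend S v) / (2 * β)) := by
  have hS := posSemidef_smul_inv_dirichletMatrix hd hβ.le S
  have key := charFun_multivariateGaussian (μ := 0) hS (toLp 2 v)
  rw [inner_zero_right, charFun_apply] at key
  have hquad : ofLp (toLp 2 v) ⬝ᵥ (β⁻¹ • (dirichletMatrix S)⁻¹) *ᵥ ofLp (toLp 2 v) =
      β⁻¹ * dirichletEnergy S (zeroExtend S v) := by
    rw [ofLp_toLp, smul_mulVec, dotProduct_smul, smul_eq_mul, dotProduct_inv_dirichletMatrix_mulVec]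
  have hint : Integrable (fun φ : EuclideanSpace ℝ S => Complex.exp (@inner ℝ _ _ φ (toLp 2 v) * Complex.I))
      (latticeGFF β S) := by
    refine Integrable.mono' (integrable_const (1 : ℝ)) ?_ (ae_of_all _ fun φ => ?_)
    · exact (Continuous.cexp (by fun_prop)).aestronglyMeasurable
    · rw [Complex.norm_exp_ofReal_mul_I]
  have hre : (∫ φ, Complex.exp (@inner ℝ _ _ φ (toLp 2 v) * Complex.I) ∂(latticeGFF β S)).re =
      ∫ φ, Real.cos (∑ x : S, v x * ofLp φ x) ∂(latticeGFF β S) := by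
    have h2 : ∫ φ, (Complex.exp (@inner ℝ _ _ φ (toLp 2 v) * Complex.I)).re ∂(latticeGFF β S) =
        (∫ φ, Complex.exp (@inner ℝ _ _ φ (toLp 2 v) * Complex.I) ∂(latticeGFF β S)).re := by
      simpa only [RCLike.re_to_complex] using integral_re hint
    rw [← h2]
    refine integral_congr_ae (ae_of_all _ fun φ => ?_)
    show (Complex.exp (((@inner ℝ _ _ φ (toLp 2 v) : ℝ) : ℂ) * Complex.I)).re = _
    rw [Complex.exp_ofReal_mul_I_re, inner_toLp_eq_sum]
  unfold latticeGFF at hre ⊢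
  rw [← hre, key, hquad, Complex.ofReal_zero, zero_mul, zero_sub]
  rw [show -( ((β⁻¹ * dirichletEnergy S (zeroExtend S v) : ℝ) : ℂ) / 2) =
      ((-(dirichletEnergy S (zeroExtend S v)) / (2 * β) : ℝ) : ℂ) by
    push_cast; field_simp]
  rw [Complex.exp_ofReal_re]

/-! ### The Gibbs form: the harmonic crystal with zero boundary condition -/

/-- `(β(-Δ_D))⁻¹ = β⁻¹ G_S` (`β ≠ 0`, `d ≥ 1`). [folklore] -/
theorem smul_dirichletMatrix_inv (hd : 0 < d) {β : ℝ} (hβ : β ≠ 0) (S : Finset (Site d)) :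
    (β • dirichletMatrix S)⁻¹ = β⁻¹ • (dirichletMatrix S)⁻¹ := by
  refine Matrix.inv_eq_right_inv ?_
  rw [Matrix.smul_mul, Matrix.mul_smul, smul_smul, mul_nonsing_inv _ (isUnit_det_dirichletMatrix hd S),
    mul_inv_cancel₀ hβ, one_smul]

/-- The Gibbs exponent: `φᵀ (β(-Δ_D)) φ = β ∑_{x ∈ ℤ^d} ∑ᵢ (φ̄(x + eᵢ) - φ̄(x))²` with `φ̄` the zero
extension of `φ` — `β` times the sum over ALL bonds of `ℤ^d` of the squared gradients (bonds
leaving `S` see the boundary value `0`). [cite: GlimmJaffe1987, §9.5 (9.5.9)–(9.5.10)] -/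
theorem dotProduct_smul_dirichletMatrix_mulVec (β : ℝ) (S : Finset (Site d)) (φ : S → ℝ) :
    φ ⬝ᵥ (β • dirichletMatrix S) *ᵥ φ =
      β * ∑ᶠ x, ∑ i : Fin d, (zeroExtend S φ (x + Pi.single i 1) - zeroExtend S φ x) ^ 2 := by
  rw [smul_mulVec, dotProduct_smul, smul_eq_mul, dotProduct_dirichletMatrix_mulVec,
    dirichletForm_eq_finsum_sq S (fun x hx => zeroExtend_of_not_mem φ hx)]

/-- The Gaussian weight of the precision matrix `β(-Δ_D)` is the Boltzmann factor
`exp(-(β/2) ∑_{bonds} (∇φ̄)²)` of the massless harmonic crystal with zero boundary condition.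
[folklore] -/
theorem gaussWeight_smul_dirichletMatrix (β : ℝ) (S : Finset (Site d)) (φ : EuclideanSpace ℝ S) :
    gaussWeight (β • dirichletMatrix S) φ = ENNReal.ofReal (Real.exp
      (-(β * ∑ᶠ x, ∑ i : Fin d, (zeroExtend S (ofLp φ) (x + Pi.single i 1) - zeroExtend S (ofLp φ) x) ^ 2) / 2)) := by
  rw [gaussWeight, dotProduct_smul_dirichletMatrix_mulVec]

/-- **The lattice GFF is the Gibbs measure of the massless harmonic crystal with zero boundary
condition**: for `β > 0` and `d ≥ 1`,
`latticeGFF β S = Z⁻¹ exp(-(β/2) ∑_{bonds} (φ̄_x - φ̄_y)²) dφ` on `ℝ^S` with `Z ∈ (0, ∞)`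
(`gaussWeight_smul_dirichletMatrix` for the weight) — the tree's
`GaussianToolkit.multivariateGaussian_inv_eq_withDensity` at the precision matrix `β(-Δ_D)`, whose
inverse is the covariance `β⁻¹ G_S` (`smul_dirichletMatrix_inv`). [folklore] -/
theorem latticeGFF_eq_withDensity (hd : 0 < d) {β : ℝ} (hβ : 0 < β) (S : Finset (Site d)) :
    latticeGFF β S = (gaussZ (β • dirichletMatrix S))⁻¹ •
        (volume : Measure (EuclideanSpace ℝ S)).withDensity (gaussWeight (β • dirichletMatrix S)) ∧
      gaussZ (β • dirichletMatrix S) ≠ 0 ∧ gaussZ (β • dirichletMatrix S) ≠ ∞ := by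
  have hP : (β • dirichletMatrix S).PosDef := (posDef_dirichletMatrix hd S).smul hβ
  have h := multivariateGaussian_inv_eq_withDensity hP
  rwa [smul_dirichletMatrix_inv hd hβ.ne' S] at h

variable (d) in
/-- **Perimeter law for the spin-wave (free photon) Wilson loop, uniformly in the volume**
(`d ≥ 4`): there is `C = C_d` such that for every `β > 0`, every finite region `S ⊆ ℤ^d` and every
`R × T` lattice rectangle inside it, the product over the components `μ` of the Gaussian
expectations `E_{GFF(β,S)} cos(φ(j_μ))` of the loop current `j = loopCurrent a i j R T` — the
Wilson loop of `d` independent massless lattice Gaussian fields with zero boundary condition off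
`S` (the Feynman-gauge lattice photon) — is at least `exp(-C (R + T)/β)`: each factor is
`exp(-E_S(j_μ)/(2β))` (`integral_cos_sum_mul_latticeGFF`) and `∑_μ E_S(j_μ) ≤ 2C (R + T)`
uniformly in `S` (`sum_dirichletEnergy_loopCurrent_le`). This is the Gaussian ("spin wave")
perimeter behaviour `exp[-(1/2β')(ε_Λ, ε_Λ)] ≥ exp[-const (L + T)/β']` of Fröhlich–Spencer 1982
(2.88), resp. `E_{GFF}[W_γ] = exp(-C_GFF |γ|(1 + o(1))/2β)` of Garban–Sepúlveda 2023 (1.3), in the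
componentwise lattice potential theory of `ℤ^d`. [cite: FrohlichSpencerCMP1982, §2.10 (2.88) (spin-wave factor; shape of the estimate)] -/
theorem exp_neg_perimeter_le_prod_integral_cos_loopCurrent (hd : 4 ≤ d) :
    ∃ C : ℝ, 0 ≤ C ∧ ∀ {β : ℝ}, 0 < β → ∀ (S : Finset (Site d)) (a : Site d) (i j : Fin d) (R T : ℕ),
      i ≠ j → loopSites a i j R T ⊆ S →
        Real.exp (-(C * (R + T)) / β) ≤
          ∏ μ, ∫ φ, Real.cos (∑ x : S, loopCurrent a i j R T x μ * ofLp φ x) ∂(latticeGFF β S) := by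
  obtain ⟨C, hC0, hC⟩ := sum_dirichletEnergy_loopCurrent_le d hd
  have hd0 : 0 < d := by omega
  refine ⟨C / 2, by positivity, fun {β} hβ S a i j R T hij hS => ?_⟩
  have hfac : ∀ μ : Fin d, ∫ φ, Real.cos (∑ x : S, loopCurrent a i j R T x μ * ofLp φ x) ∂(latticeGFF β S) =
      Real.exp (-dirichletEnergy S (fun x => loopCurrent a i j R T x μ) / (2 * β)) := by
    intro μ
    rw [integral_cos_sum_mul_latticeGFF hd0 hβ S (fun x : S => loopCurrent a i j R T x μ),
      dirichletEnergy_congr (f := zeroExtend S fun y : S => loopCurrent a i j R T y μ)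
        (g := fun x => loopCurrent a i j R T x μ) (fun x hx => zeroExtend_of_mem _ hx)]
  simp_rw [hfac]
  rw [← Real.exp_sum, Real.exp_le_exp, ← Finset.sum_div, Finset.sum_neg_distrib, neg_div, neg_div,
    neg_le_neg_iff, div_le_iff₀ (by positivity : (0 : ℝ) < 2 * β)]
  have h := hC S a i j R T hij hS
  calc ∑ μ, dirichletEnergy S (fun x => loopCurrent a i j R T x μ) ≤ C * (R + T) := h
    _ = C / 2 * (R + T) / β * (2 * β) := by field_simp

end Literature.Probability.LatticeModels
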